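import Summits.CriticalPhenomena.CardyFormulaZ2.Theorems.CardyFlipRussoVoronoiHubFromSmirnovStubMeasurableCrossEventHitting
import Literature.Topology.PlaneTopology.BandCrossing
import HarnessLib

/-!
# The continuum crossing event is measurable; reduction of S0 to plane topology (stub `stub_measurableCrossEvent`, part 2)

Helper file `--supports stmt-CriticalPhenomena-6433` (line `moebius-exact-delaunay-dilation-ward`,
stub S0 `stub_measurableCrossEvent` of the crux `VoronoiHubFromSmirnov`).  Write
`K(c) = closure Ω ∩ {z | infDist (z/δ) c.1 ≤ infDist (z/δ) c.2}` for the compact set of black points of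
`closure Ω` at mesh `δ` (`c = (black nuclei, white nuclei)`), `A = R.arc 0`, `A' = R.arc 2`.

* `exists_isPreconnected_iff_forall_chain` — **ε-chain characterisation of continuum connections**
  (general topology of compacta): for `K` compact and `A, A'` closed, some connected `C ⊆ K` meets `A`
  and `A'` iff for every `ε > 0` an `ε`-chain of points of `K` leads from `K ∩ A` to `K ∩ A'`
  (`⇒`: the chain relation has open classes on a connected set, `IsPreconnected.induction₂'`;
  `⇐`: cut-wire theorem `Literature.Topology.PlaneTopology.exists_closed_separation` and the positive
  distance between the two compact halves).
* `exists_ballChain_of_chain`, `exists_chain_of_ballChain`, `exists_isPreconnected_iff_forall_ballChain`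
  — the same with chains of closed balls of radius `1/(n+1)` centred at a COUNTABLE dense set, each
  meeting `K` (losing a factor `5` in `ε`), so that the condition is a countable Boolean combination of
  hitting events `{K ∩ F ≠ ∅}`, `F` compact;
* `measurableSet_setOf_reflTransGen`, `measurableSet_exists_isPreconnected` — hence, for any
  measurable family of compact sets `c ↦ K(c)` with measurable hitting events, the event "some connected
  subset of `K(c)` meets `A` and `A'`" is measurable;
* `measurableSet_continuumCrossEvent` — the CONTINUUM form of the crux's crossing event,
  `{c | ∃ C ⊆ K(c) connected, C ∩ arc 0 ≠ ∅, C ∩ arc 2 ≠ ∅}`, is measurable for every conformal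
  rectangle and every mesh (hitting events: `measurableSet_blackRegion_inter_nonempty`);
* `crossEvent_subset_continuumCrossEvent`, `measurableSet_crossEvent_of_joined` — the path event
  `crossEvent R δ` is contained in the continuum event, and S0 FOLLOWS from the plane-topological
  statement "every connected subset of `K(c)` meeting both arcs yields a path in `K(c)` between them"
  (path-connectedness of the relevant components of `closure Ω ∩` (finite union of closed convex
  Voronoi pieces)), which is isolated here as the exact remaining obligation of the stub.
-/

noncomputable section

namespace Summit.CriticalPhenomena.CardyFormulaZ2.Cruxes.VoronoiHubFromSmirnov.MoebiusExactDelaunayDilationWard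

open scoped Topology
open Set MeasureTheory Metric Filter
open Literature.Analysis.FunctionSpaces
open Literature.Probability.RandomPlanarGeometry
open Literature.Topology.PlaneTopology

/-! ### `ε`-chains in a compact set -/

/-- **Continuum connections are `ε`-chain connections, for all `ε`.** For `K ⊆ ℂ` compact and `A`,
`A'` closed: some preconnected `C ⊆ K` meets both `A` and `A'` iff for every `ε > 0` there is a finite
chain of points of `K`, consecutive ones at distance `≤ ε`, from a point of `K ∩ A` to a point of
`K ∩ A'` (compact Hausdorff spaces: quasi-components are components; cut-wire theorem). -/
theorem exists_isPreconnected_iff_forall_chain {K A A' : Set ℂ} (hK : IsCompact K) (hA : IsClosed A)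
    (hA' : IsClosed A') :
    (∃ C ⊆ K, IsPreconnected C ∧ (C ∩ A).Nonempty ∧ (C ∩ A').Nonempty) ↔
      ∀ ε > (0 : ℝ), ∃ a ∈ K ∩ A, ∃ a' ∈ K ∩ A',
        Relation.ReflTransGen (fun x y => x ∈ K ∧ y ∈ K ∧ dist x y ≤ ε) a a' := by
  constructor
  · rintro ⟨C, hCK, hC, ⟨a, haC, haA⟩, ⟨a', ha'C, ha'A'⟩⟩ ε hε
    refine ⟨a, ⟨hCK haC, haA⟩, a', ⟨hCK ha'C, ha'A'⟩, ?_⟩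
    refine hC.induction₂' (fun x y => Relation.ReflTransGen
      (fun x y => x ∈ K ∧ y ∈ K ∧ dist x y ≤ ε) x y) ?_ ?_ haC ha'C
    · intro x hx
      filter_upwards [inter_mem_nhdsWithin C (ball_mem_nhds x hε)] with y hy
      exact ⟨Relation.ReflTransGen.single ⟨hCK hx, hCK hy.1, (mem_ball'.1 hy.2).le⟩,
        Relation.ReflTransGen.single ⟨hCK hy.1, hCK hx, by
          rw [dist_comm]; exact (mem_ball'.1 hy.2).le⟩⟩
    · intro x y z _ _ _ hxy hyz
      exact hxy.trans hyz
  · intro h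
    by_contra hne
    have hne' : ∀ C ⊆ K, IsPreconnected C → (C ∩ A).Nonempty → (C ∩ A').Nonempty → False :=
      fun C hCK hC h1 h2 => hne ⟨C, hCK, hC, h1, h2⟩
    obtain ⟨Z₁, Z₂, hZ₁, hZ₂, hdisj, hunion, hZ₁A', hZ₂A⟩ := exists_closed_separation hK hA hA' hne'
    have hZ₁c : IsCompact Z₁ := hK.of_isClosed_subset hZ₁ (hunion ▸ subset_union_left)
    have memZ₁ : ∀ x ∈ K, x ∈ A → x ∈ Z₁ := fun x hx hxA => by
      rw [← hunion] at hx
      exact hx.resolve_right fun h2 => Set.disjoint_left.1 hZ₂A h2 hxA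
    -- the two halves are at positive distance
    obtain ⟨η, hη, hηZ⟩ := hdisj.exists_cthickenings hZ₁c hZ₂
    have hfar : ∀ x ∈ Z₁, ∀ y ∈ Z₂, η < dist x y := by
      intro x hx y hy
      by_contra hle
      push Not at hle
      exact Set.disjoint_left.1 hηZ (self_subset_cthickening _ hx)
        (mem_cthickening_of_dist_le x y η Z₂ hy hle)
    obtain ⟨a, ⟨haK, haA⟩, a', ⟨-, ha'A'⟩, hchain⟩ := h η hη
    have stay : ∀ y, Relation.ReflTransGen (fun x y => x ∈ K ∧ y ∈ K ∧ dist x y ≤ η) a y →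
        y ∈ Z₁ := by
      intro y hy
      induction hy with
      | refl => exact memZ₁ a haK haA
      | tail _ hst ih =>
        obtain ⟨-, hcK, hd⟩ := hst
        rw [← hunion] at hcK
        rcases hcK with h1 | h2
        · exact h1
        · exact absurd hd (not_le.2 (hfar _ ih _ h2))
    exact Set.disjoint_left.1 hZ₁A' (stay a' hchain) ha'A'

section Chains

variable {β : Type*} (e : β → ℂ)

/-- **From `ε`-chains of points to `ε`-chains of balls centred in a dense set.** If an `ε`-chain of
points of `K` leads from `K ∩ A` to `K ∩ A'`, then there is a chain of closed `ε`-balls centred at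
points `e v` of the dense family, consecutive centres at distance `≤ 3ε`, each ball meeting `K`, the
first meeting `K ∩ A` and the last meeting `K ∩ A'`. -/
theorem exists_ballChain_of_chain (he : DenseRange e) {K A A' : Set ℂ} {ε : ℝ} (hε : 0 < ε)
    (h : ∃ a ∈ K ∩ A, ∃ a' ∈ K ∩ A',
      Relation.ReflTransGen (fun x y => x ∈ K ∧ y ∈ K ∧ dist x y ≤ ε) a a') :
    ∃ v w : β, (closedBall (e v) ε ∩ (K ∩ A)).Nonempty ∧ (closedBall (e w) ε ∩ (K ∩ A')).Nonempty ∧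
      Relation.ReflTransGen (fun v w : β => dist (e v) (e w) ≤ 3 * ε ∧
        (closedBall (e v) ε ∩ K).Nonempty ∧ (closedBall (e w) ε ∩ K).Nonempty) v w := by
  obtain ⟨a, ha, a', ha', hch⟩ := h
  obtain ⟨v, hv⟩ := he.exists_dist_lt a hε
  have main : ∀ y, Relation.ReflTransGen (fun x y => x ∈ K ∧ y ∈ K ∧ dist x y ≤ ε) a y → y ∈ K →
      ∃ w : β, dist y (e w) < ε ∧ Relation.ReflTransGen (fun v w : β => dist (e v) (e w) ≤ 3 * ε ∧
        (closedBall (e v) ε ∩ K).Nonempty ∧ (closedBall (e w) ε ∩ K).Nonempty) v w := by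
    intro y hy
    induction hy with
    | refl => exact fun _ => ⟨v, hv, Relation.ReflTransGen.refl⟩
    | @tail b c _ hst ih =>
      intro hcK
      obtain ⟨hbK, -, hbc⟩ := hst
      obtain ⟨w, hw, hvw⟩ := ih hbK
      obtain ⟨w', hw'⟩ := he.exists_dist_lt c hε
      refine ⟨w', hw', hvw.tail ⟨?_, ⟨b, mem_closedBall.2 hw.le, hbK⟩,
        ⟨c, mem_closedBall.2 hw'.le, hcK⟩⟩⟩
      calc dist (e w) (e w') ≤ dist (e w) b + dist b c + dist c (e w') := dist_triangle4 _ _ _ _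
        _ ≤ ε + ε + ε :=
          add_le_add (add_le_add (by rw [dist_comm]; exact hw.le) hbc) hw'.le
        _ = 3 * ε := by ring
  obtain ⟨w, hw, hvw⟩ := main a' hch ha'.1
  exact ⟨v, w, ⟨a, mem_closedBall.2 hv.le, ha⟩, ⟨a', mem_closedBall.2 hw.le, ha'⟩, hvw⟩

/-- **From chains of balls back to chains of points** (losing a factor `5`): a chain of closed
`ε`-balls with consecutive centres at distance `≤ 3ε`, each meeting `K`, the first meeting `K ∩ A`
and the last `K ∩ A'`, yields a `5ε`-chain of points of `K` from `K ∩ A` to `K ∩ A'`. -/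
theorem exists_chain_of_ballChain {K A A' : Set ℂ} {ε : ℝ}
    (h : ∃ v w : β, (closedBall (e v) ε ∩ (K ∩ A)).Nonempty ∧ (closedBall (e w) ε ∩ (K ∩ A')).Nonempty ∧
      Relation.ReflTransGen (fun v w : β => dist (e v) (e w) ≤ 3 * ε ∧
        (closedBall (e v) ε ∩ K).Nonempty ∧ (closedBall (e w) ε ∩ K).Nonempty) v w) :
    ∃ a ∈ K ∩ A, ∃ a' ∈ K ∩ A',
      Relation.ReflTransGen (fun x y => x ∈ K ∧ y ∈ K ∧ dist x y ≤ 5 * ε) a a' := by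
  obtain ⟨v, w, ⟨a, hav, haK, haA⟩, ⟨a', ha'w, ha'K, ha'A'⟩, hch⟩ := h
  refine ⟨a, ⟨haK, haA⟩, a', ⟨ha'K, ha'A'⟩, ?_⟩
  have hε : 0 ≤ ε := dist_nonneg.trans (mem_closedBall.1 hav)
  have main : ∀ w, Relation.ReflTransGen (fun v w : β => dist (e v) (e w) ≤ 3 * ε ∧
        (closedBall (e v) ε ∩ K).Nonempty ∧ (closedBall (e w) ε ∩ K).Nonempty) v w →
      ∀ z, z ∈ closedBall (e w) ε → z ∈ K →
        Relation.ReflTransGen (fun x y => x ∈ K ∧ y ∈ K ∧ dist x y ≤ 5 * ε) a z := by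
    intro w hw
    induction hw with
    | refl =>
      intro z hz hzK
      refine Relation.ReflTransGen.single ⟨haK, hzK, ?_⟩
      calc dist a z ≤ dist a (e v) + dist (e v) z := dist_triangle _ _ _
        _ ≤ ε + ε := add_le_add (mem_closedBall.1 hav) (mem_closedBall'.1 hz)
        _ ≤ 5 * ε := by linarith
    | @tail w₁ w₂ _ hst ih =>
      intro z hz hzK
      obtain ⟨hd, ⟨u, hu, huK⟩, -⟩ := hst
      refine (ih u hu huK).tail ⟨huK, hzK, ?_⟩
      calc dist u z ≤ dist u (e w₁) + dist (e w₁) (e w₂) + dist (e w₂) z := dist_triangle4 _ _ _ _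
        _ ≤ ε + 3 * ε + ε :=
          add_le_add (add_le_add (mem_closedBall.1 hu) hd) (mem_closedBall'.1 hz)
        _ = 5 * ε := by ring
  exact main w hch a' ha'w ha'K

/-- **Continuum connections via countably many ball chains.** For `K` compact, `A, A'` closed and a
dense family `e`: some preconnected `C ⊆ K` meets `A` and `A'` iff for every `n` there is a chain of
closed balls of radius `1/(n+1)` centred at points of the family, consecutive centres at distance
`≤ 3/(n+1)`, each meeting `K`, from one meeting `K ∩ A` to one meeting `K ∩ A'`. -/
theorem exists_isPreconnected_iff_forall_ballChain (he : DenseRange e) {K A A' : Set ℂ}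
    (hK : IsCompact K) (hA : IsClosed A) (hA' : IsClosed A') :
    (∃ C ⊆ K, IsPreconnected C ∧ (C ∩ A).Nonempty ∧ (C ∩ A').Nonempty) ↔
      ∀ n : ℕ, ∃ v w : β, (closedBall (e v) (1 / ((n : ℝ) + 1)) ∩ (K ∩ A)).Nonempty ∧
        (closedBall (e w) (1 / ((n : ℝ) + 1)) ∩ (K ∩ A')).Nonempty ∧
        Relation.ReflTransGen (fun v w : β => dist (e v) (e w) ≤ 3 * (1 / ((n : ℝ) + 1)) ∧
          (closedBall (e v) (1 / ((n : ℝ) + 1)) ∩ K).Nonempty ∧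
          (closedBall (e w) (1 / ((n : ℝ) + 1)) ∩ K).Nonempty) v w := by
  rw [exists_isPreconnected_iff_forall_chain hK hA hA']
  constructor
  · intro h n
    exact exists_ballChain_of_chain e he Nat.one_div_pos_of_nat (h _ Nat.one_div_pos_of_nat)
  · intro h ε hε
    obtain ⟨n, hn⟩ := exists_nat_one_div_lt (show 0 < ε / 5 by positivity)
    obtain ⟨a, ha, a', ha', hch⟩ := exists_chain_of_ballChain e (h n)
    have hle : ∀ x y : ℂ, (x ∈ K ∧ y ∈ K ∧ dist x y ≤ 5 * (1 / ((n : ℝ) + 1))) →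
        (x ∈ K ∧ y ∈ K ∧ dist x y ≤ ε) :=
      fun x y hxy => ⟨hxy.1, hxy.2.1, hxy.2.2.trans (by linarith)⟩
    exact ⟨a, ha, a', ha', Relation.ReflTransGen.mono hle a a' hch⟩

/-! ### Measurability -/

variable {α : Type*} [MeasurableSpace α]

/-- **Reachability along a measurably varying relation on a countable type is measurable**: if
`{c | S c v w}` is measurable for all `v w : β` (`β` countable), then so is
`{c | ReflTransGen (S c) v w}` (a countable union over the finite lists of intermediate points). -/
theorem measurableSet_setOf_reflTransGen [Countable β] {S : α → β → β → Prop}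
    (hS : ∀ v w, MeasurableSet {c | S c v w}) (v w : β) :
    MeasurableSet {c | Relation.ReflTransGen (S c) v w} := by
  have key : {c | Relation.ReflTransGen (S c) v w} =
      ⋃ l : List β, {c | List.IsChain (S c) (v :: l) ∧ (v :: l).getLast (List.cons_ne_nil _ _) = w} := by
    ext c
    simp only [mem_setOf_eq, mem_iUnion]
    exact ⟨List.exists_isChain_cons_of_relationReflTransGen,
      fun ⟨l, hl, hlast⟩ => List.relationReflTransGen_of_exists_isChain_cons l hl hlast⟩
  rw [key]
  refine MeasurableSet.iUnion fun l => ?_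
  have hchain : ∀ (l : List β) (v : β), MeasurableSet {c | List.IsChain (S c) (v :: l)} := by
    intro l
    induction l with
    | nil => intro v; simp only [List.isChain_singleton, setOf_true, MeasurableSet.univ]
    | cons u l ih =>
      intro v
      simp only [List.isChain_cons_cons, setOf_and]
      exact (hS v u).inter (ih u)
  rw [setOf_and]
  exact (hchain l v).inter (MeasurableSet.const _)

/-- **The ball-chain event is measurable** for a family of sets `c ↦ K c` whose hitting events by
compact sets are measurable (and `A, A'` closed). -/
theorem measurableSet_ballChain [Countable β] (K : α → Set ℂ)
    (hK : ∀ F : Set ℂ, IsCompact F → MeasurableSet {c | (F ∩ K c).Nonempty})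
    {A A' : Set ℂ} (hA : IsClosed A) (hA' : IsClosed A') (ε : ℝ) :
    MeasurableSet {c | ∃ v w : β, (closedBall (e v) ε ∩ (K c ∩ A)).Nonempty ∧
      (closedBall (e w) ε ∩ (K c ∩ A')).Nonempty ∧
      Relation.ReflTransGen (fun v w : β => dist (e v) (e w) ≤ 3 * ε ∧
        (closedBall (e v) ε ∩ K c).Nonempty ∧ (closedBall (e w) ε ∩ K c).Nonempty) v w} := by
  have h1 : ∀ v, MeasurableSet {c | (closedBall (e v) ε ∩ K c).Nonempty} := fun v =>
    hK _ (isCompact_closedBall _ _)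
  have h2 : ∀ (E : Set ℂ), IsClosed E → ∀ v,
      MeasurableSet {c | (closedBall (e v) ε ∩ (K c ∩ E)).Nonempty} := fun E hE v => by
    have : ∀ c, closedBall (e v) ε ∩ (K c ∩ E) = (closedBall (e v) ε ∩ E) ∩ K c := fun c => by
      rw [inter_comm (K c), inter_assoc]
    simp_rw [this]
    exact hK _ ((isCompact_closedBall _ _).inter_right hE)
  have hS : ∀ v w, MeasurableSet {c | dist (e v) (e w) ≤ 3 * ε ∧
      (closedBall (e v) ε ∩ K c).Nonempty ∧ (closedBall (e w) ε ∩ K c).Nonempty} := fun v w => by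
    simp only [setOf_and]
    exact (MeasurableSet.const _).inter ((h1 v).inter (h1 w))
  have hset : {c | ∃ v w : β, (closedBall (e v) ε ∩ (K c ∩ A)).Nonempty ∧
      (closedBall (e w) ε ∩ (K c ∩ A')).Nonempty ∧
      Relation.ReflTransGen (fun v w : β => dist (e v) (e w) ≤ 3 * ε ∧
        (closedBall (e v) ε ∩ K c).Nonempty ∧ (closedBall (e w) ε ∩ K c).Nonempty) v w} =
      ⋃ v : β, ⋃ w : β, {c | (closedBall (e v) ε ∩ (K c ∩ A)).Nonempty} ∩
        ({c | (closedBall (e w) ε ∩ (K c ∩ A')).Nonempty} ∩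
        {c | Relation.ReflTransGen (fun v w : β => dist (e v) (e w) ≤ 3 * ε ∧
          (closedBall (e v) ε ∩ K c).Nonempty ∧ (closedBall (e w) ε ∩ K c).Nonempty) v w}) := by
    ext c
    simp only [mem_setOf_eq, mem_iUnion, mem_inter_iff]
  rw [hset]
  exact MeasurableSet.iUnion fun v => MeasurableSet.iUnion fun w =>
    (h2 A hA v).inter ((h2 A' hA' w).inter (measurableSet_setOf_reflTransGen hS v w))

end Chains

/-- **Measurability of continuum connections for a random compact set given by its hitting events.**
If `c ↦ K c` takes compact values and all hitting events `{c | F ∩ K c ≠ ∅}`, `F` compact, are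
measurable, then for closed `A, A'` the event "some connected subset of `K c` meets `A` and `A'`" is
measurable (it is `⋂ₙ` of ball-chain events at radius `1/(n+1)` over a countable dense set of centres). -/
theorem measurableSet_exists_isPreconnected {α : Type*} [MeasurableSpace α] (K : α → Set ℂ)
    (hKc : ∀ c, IsCompact (K c))
    (hK : ∀ F : Set ℂ, IsCompact F → MeasurableSet {c | (F ∩ K c).Nonempty})
    {A A' : Set ℂ} (hA : IsClosed A) (hA' : IsClosed A') :
    MeasurableSet {c | ∃ C ⊆ K c, IsPreconnected C ∧ (C ∩ A).Nonempty ∧ (C ∩ A').Nonempty} := by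
  obtain ⟨D, hDc, hDd⟩ := TopologicalSpace.exists_countable_dense ℂ
  haveI : Countable D := hDc.to_subtype
  have he : DenseRange ((↑) : D → ℂ) := hDd.denseRange_val
  have hset : {c | ∃ C ⊆ K c, IsPreconnected C ∧ (C ∩ A).Nonempty ∧ (C ∩ A').Nonempty} =
      ⋂ n : ℕ, {c | ∃ v w : D, (closedBall ((v : ℂ)) (1 / ((n : ℝ) + 1)) ∩ (K c ∩ A)).Nonempty ∧
        (closedBall ((w : ℂ)) (1 / ((n : ℝ) + 1)) ∩ (K c ∩ A')).Nonempty ∧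
        Relation.ReflTransGen (fun v w : D => dist (v : ℂ) (w : ℂ) ≤ 3 * (1 / ((n : ℝ) + 1)) ∧
          (closedBall (v : ℂ) (1 / ((n : ℝ) + 1)) ∩ K c).Nonempty ∧
          (closedBall (w : ℂ) (1 / ((n : ℝ) + 1)) ∩ K c).Nonempty) v w} := by
    ext c
    simp only [mem_setOf_eq, mem_iInter]
    exact exists_isPreconnected_iff_forall_ballChain ((↑) : D → ℂ) he (hKc c) hA hA'
  rw [hset]
  exact MeasurableSet.iInter fun n => measurableSet_ballChain ((↑) : D → ℂ) K hK hA hA' _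

/-! ### The crux's crossing event -/

/-- **The continuum crossing event is measurable.** For every conformal rectangle `R` and every mesh
`δ`, the set of pairs of configurations `c` for which some CONNECTED subset of
`K(c) = closure Ω ∩ {z | infDist (z/δ) c.1 ≤ infDist (z/δ) c.2}` meets both arcs `R.arc 0` and
`R.arc 2` is measurable in the product of the count σ-algebras (hitting events of the black region,
`measurableSet_blackRegion_inter_nonempty`, and the `ε`-chain characterisation). -/
theorem measurableSet_continuumCrossEvent : ∀ (R : ConformalRectangle) (δ : ℝ), MeasurableSet {c : PointConfig ℂ × PointConfig ℂ | ∃ C ⊆ closure R.carrier ∩ {z | Metric.infDist (z / (δ : ℂ)) (c.1 : Set ℂ) ≤ Metric.infDist (z / (δ : ℂ)) (c.2 : Set ℂ)}, IsPreconnected C ∧ (C ∩ R.arc 0).Nonempty ∧ (C ∩ R.arc 2).Nonempty} := by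
  intro R δ
  refine measurableSet_exists_isPreconnected
    (fun c : PointConfig ℂ × PointConfig ℂ => closure R.carrier ∩
      {z | infDist (z / (δ : ℂ)) (c.1 : Set ℂ) ≤ infDist (z / (δ : ℂ)) (c.2 : Set ℂ)})
    (fun c => R.isBounded.isCompact_closure.inter_right (isClosed_setOf_infDist_div_le δ c))
    (fun F hF => ?_) (R.isClosed_arc 0) (R.isClosed_arc 2)
  have : ∀ c : PointConfig ℂ × PointConfig ℂ, F ∩ (closure R.carrier ∩
      {z | infDist (z / (δ : ℂ)) (c.1 : Set ℂ) ≤ infDist (z / (δ : ℂ)) (c.2 : Set ℂ)}) =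
      (F ∩ closure R.carrier) ∩
        {z | infDist (z / (δ : ℂ)) (c.1 : Set ℂ) ≤ infDist (z / (δ : ℂ)) (c.2 : Set ℂ)} :=
    fun c => (inter_assoc _ _ _).symm
  simp_rw [this]
  exact measurableSet_blackRegion_inter_nonempty _ (hF.inter_right isClosed_closure) δ

/-- The path crossing event of the crux is contained in the continuum crossing event (the range of a
joining path is a connected subset of `K(c)` meeting both arcs). -/
theorem crossEvent_subset_continuumCrossEvent (R : ConformalRectangle) (δ : ℝ) :
    crossEvent R δ ⊆ {c : PointConfig ℂ × PointConfig ℂ | ∃ C ⊆ closure R.carrier ∩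
      {z | Metric.infDist (z / (δ : ℂ)) (c.1 : Set ℂ) ≤ Metric.infDist (z / (δ : ℂ)) (c.2 : Set ℂ)},
      IsPreconnected C ∧ (C ∩ R.arc 0).Nonempty ∧ (C ∩ R.arc 2).Nonempty} := by
  rintro c ⟨x, hx, y, hy, γ, hγ⟩
  exact ⟨range γ, range_subset_iff.2 hγ, isPreconnected_range γ.continuous,
    ⟨x, ⟨0, γ.source⟩, hx⟩, ⟨y, ⟨1, γ.target⟩, hy⟩⟩

/-- **Reduction of S0 to plane topology.** If, for every pair of configurations `c`, every connected
subset of `K(c) = closure Ω ∩ {z | infDist (z/δ) c.1 ≤ infDist (z/δ) c.2}` meeting `R.arc 0` and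
`R.arc 2` can be replaced by a PATH in `K(c)` from `R.arc 0` to `R.arc 2` (path-connectedness of the
components of `K(c)` through the two arcs — `K(c)` is `closure Ω` cut by finitely many closed convex
Voronoi pieces near `closure Ω`), then the crux's crossing event `crossEvent R δ` equals the continuum
crossing event and is therefore measurable. -/
theorem measurableSet_crossEvent_of_joined : ∀ (R : ConformalRectangle) (δ : ℝ), (∀ (c : PointConfig ℂ × PointConfig ℂ) (C : Set ℂ), C ⊆ closure R.carrier ∩ {z | Metric.infDist (z / (δ : ℂ)) (c.1 : Set ℂ) ≤ Metric.infDist (z / (δ : ℂ)) (c.2 : Set ℂ)} → IsPreconnected C → (C ∩ R.arc 0).Nonempty → (C ∩ R.arc 2).Nonempty → c ∈ crossEvent R δ) → MeasurableSet (crossEvent R δ) := by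
  intro R δ h
  have hEq : crossEvent R δ = {c : PointConfig ℂ × PointConfig ℂ | ∃ C ⊆ closure R.carrier ∩
      {z | Metric.infDist (z / (δ : ℂ)) (c.1 : Set ℂ) ≤ Metric.infDist (z / (δ : ℂ)) (c.2 : Set ℂ)},
      IsPreconnected C ∧ (C ∩ R.arc 0).Nonempty ∧ (C ∩ R.arc 2).Nonempty} :=
    (crossEvent_subset_continuumCrossEvent R δ).antisymm fun c ⟨C, hCK, hC, h1, h2⟩ =>
      h c C hCK hC h1 h2
  rw [hEq]
  exact measurableSet_continuumCrossEvent R δ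

end Summit.CriticalPhenomena.CardyFormulaZ2.Cruxes.VoronoiHubFromSmirnov.MoebiusExactDelaunayDilationWard

end
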